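import Literature.AnabelianGeometry.AbsoluteAnabelian.HolomorphicEllipticCuspidalization
import Literature.Geometry.Kaehler.ComplexTorusIsogenies
import Literature.Geometry.Kaehler.ComplexTorusLieGroup
import Literature.Geometry.Kaehler.ComplexTorusHolomorphicMaps
import Literature.AnabelianGeometry.AbsoluteAnabelian.AbsTopIII.RemarksArchimedeanLocalProofs
import Mathlib.Analysis.Normed.Module.Connected
import Mathlib.LinearAlgebra.Complex.FiniteDimensional
import Mathlib.Topology.Instances.Rat
import HarnessLib

/-!
# [AbsTopIII] Cor 2.7 (b)(c) sub-DAG: the routine sub-nodes at the model, PROVED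

Proof-only companion (theorems only, no new definitions) of
`HolomorphicEllipticCuspidalization.lean` (p414370; sub-DAG of [AbsTopIII] Corollary 2.7
(a)(b)(c)(e), S. Mochizuki, *Topics in absolute anabelian geometry III*, kurims pp. 58–60, lit key
`paper:url-5493eb38cbb7`; table `plan/L4/SUBDAG-AbsTopIII-Cor-27.md`).  Discharged here, over the
tree's complex-torus library (`Literature.Geometry.Kaehler.ComplexTorus Φ`):

* `torsionPointsDense_holds` — sub-node (c).1 `TorsionPointsDense`: the torsion points of a complex
  torus `T = (ℝ/ℤ)^ι` are dense (rational points of `ℝ/ℤ` have finite order and are dense;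
  `dense_pi`);
* `nsmulImmComplement_holds` — sub-node (b).5 `NsmulImmComplement`: the complement of the image of
  `𝕌_N ↪ 𝔼` is the finite set of non-zero `N`-torsion points ("the complement of a finite subset of
  `E^top`", p. 59);
* `isConnected_puncturedTorus` / `connectedSpace_puncturedTorus` — `𝔼 = T ∖ {0}` is connected
  (image under the universal covering `ℂ → T` of the complement of the countable lattice, which is
  path connected as `dim_ℝ ℂ = 2 > 1`);
* `contMDiff_nsmulCov`, `contMDiff_nsmulImm` — `[N] : 𝕌_N → 𝔼` and `𝕌_N ↪ 𝔼` are holomorphic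
  (`ComplexTorus.contMDiff_zsmul`, `contMDiff_inclusion`), whence `nsmulCoholomorphic_holds` —
  sub-node (b).6 `NsmulCoholomorphic` ("`E ↩ U`, `U → E` are co-holomorphic", p. 59, in the
  Riemann-surface form `IsCoHolomorphicRS`);
* `onePointPuncturedTorus_holds` — sub-node (c).6 `OnePointPuncturedTorus`: "[the one-point
  compactification of] `E^top`" is the torus (Mathlib `OnePoint.equivOfIsEmbeddingOfRangeEq`);
* sub-node (b).1 `NsmulCovIsFiniteEtale` is seat abc-iut-w5-d226's
  `HolomorphicEllipticCuspidalizationFiniteEtale.lean` (p414959: `isFiniteEtale_nsmulCov`,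
  `nsmulCovIsFiniteEtale_holds`); for the étaleness of `[N]` needed in (b).2 this file keeps a PRIVATE
  copy of the covering-map step (`[N] = ρ(N • 1)` is an isogeny, `ComplexTorus.isIsogeny_smul_one`,
  restricted to `𝕌_N` by `IsCoveringMap.restrictPreimage`), so that it does not wait on that module;
* `nsmulCovIsMorphism_holds`, `nsmulImmIsMorphism_holds` (with `isOpenEmbedding_nsmulImm`) —
  sub-nodes (b).2 `NsmulCovIsMorphism` and (b).4 `NsmulImmIsMorphism`: an étale holomorphic map of
  Riemann surfaces is a morphism of the associated Aut-holomorphic spaces (abc-iut-L4-t8's converse of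
  Cor 2.3 (i), `isLocalMorphism_ofCharted_of_isRCHolomorphic`, `RemarksArchimedeanLocalProofs.lean`).

HONEST FRAMING: OUR kernel checks of elementary steps at the model of a statement of a refereed
paper; nothing here bears on the disputed [IUTchIII] Cor. 3.12.
-/

noncomputable section

namespace Literature.AnabelianGeometry.AbsoluteAnabelian

namespace HolomorphicEllipticCuspidalization

open _root_.TopologicalSpace _root_.Topology _root_.Filter _root_.Set
open scoped _root_.Manifold _root_.ContDiff
open Literature.Geometry.Kaehler (ComplexTorus)
open Literature.Geometry.Kaehler.ComplexTorus (cover latticeVec cover_surjective cover_eq_zero_iff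
  continuous_cover)

variable {ι : Type} [Fintype ι] (Φ : (ι → ℝ) ≃L[ℝ] ℂ)

/-! ### (c).1: the torsion points of a complex torus are dense -/

/-- The points of finite order of the circle `ℝ/ℤ` are dense (they contain the classes of the
rationals). [cite: MochizukiAbsTopIII2015, Corollary 2.7 (c) p.59] -/
theorem dense_isOfFinAddOrder_addCircle : Dense {a : AddCircle (1 : ℝ) | IsOfFinAddOrder a} := by
  haveI : Fact ((0 : ℝ) < 1) := ⟨one_pos⟩
  have hc : Continuous (QuotientAddGroup.mk' (AddSubgroup.zmultiples (1 : ℝ)) : ℝ → AddCircle (1 : ℝ)) :=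
    AddCircle.continuous_mk' (1 : ℝ)
  have hs : Function.Surjective
      (QuotientAddGroup.mk' (AddSubgroup.zmultiples (1 : ℝ)) : ℝ → AddCircle (1 : ℝ)) :=
    QuotientAddGroup.mk'_surjective _
  have hd : Dense ((QuotientAddGroup.mk' (AddSubgroup.zmultiples (1 : ℝ)) : ℝ → AddCircle (1 : ℝ)) ''
      range ((↑) : ℚ → ℝ)) :=
    hs.denseRange.dense_image hc (Rat.denseRange_cast : Dense (Set.range ((↑) : ℚ → ℝ)))
  refine hd.mono ?_
  rintro _ ⟨_, ⟨q, rfl⟩, rfl⟩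
  show IsOfFinAddOrder (((q : ℝ) : ℝ) : AddCircle (1 : ℝ))
  rw [AddCircle.isOfFinAddOrder_iff_exists_rat_eq_div]
  exact ⟨q, by rw [div_one]⟩

/-- **Sub-node (c).1 PROVED**: the torsion points of a complex torus `ℂ/Φ(ℤ^ι)` (topologically
`(ℝ/ℤ)^ι`) are dense. [cite: MochizukiAbsTopIII2015, Corollary 2.7 (c) p.59] -/
theorem torsionPointsDense_holds :
    Literature.AnabelianGeometry.AbsoluteAnabelian.HolomorphicEllipticCuspidalization.TorsionPointsDense := by
  intro ι _ Φ
  have hpi : Dense (Set.pi Set.univ fun _ : ι => {a : AddCircle (1 : ℝ) | IsOfFinAddOrder a}) :=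
    dense_pi Set.univ fun _ _ => dense_isOfFinAddOrder_addCircle
  refine hpi.mono ?_
  intro x hx
  have hx' : ∀ i, IsOfFinAddOrder ((x : ι → AddCircle (1 : ℝ)) i) := fun i => hx i (Set.mem_univ i)
  exact IsOfFinAddOrder.pi hx'

/-! ### (b).5: the complement of the image of `𝕌_N ↪ 𝔼` -/

/-- A point of `𝔼` lies off the image of `𝕌_N ↪ 𝔼` iff it is an `N`-torsion point.
[cite: MochizukiAbsTopIII2015, Corollary 2.7 (b) p.59] -/
theorem not_mem_range_nsmulImm_iff (N : ℕ) (x : puncturedTorus Φ) :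
    x ∈ (Set.range (nsmulImm Φ N))ᶜ ↔ N • (x : ComplexTorus Φ) = 0 := by
  rw [Set.mem_compl_iff, Set.mem_range, not_exists]
  constructor
  · intro h
    by_contra hN
    exact h ⟨(x : ComplexTorus Φ), hN⟩ (Subtype.ext rfl)
  · rintro h u rfl
    exact u.2 h

/-- **Sub-node (b).5 PROVED**: the complement of the image of `𝕌_N ↪ 𝔼` is finite and consists of
the non-zero `N`-torsion points (the `N`-torsion of `(ℝ/ℤ)^ι` lies in the finite product of the
`N`-torsion sets of the circle factors; cf. abc-iut-w5-d226's `finite_nsmul_eq_zero` for the same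
finiteness via the isogeny kernel). [cite: MochizukiAbsTopIII2015, Corollary 2.7 (b) p.59] -/
theorem nsmulImmComplement_holds :
    Literature.AnabelianGeometry.AbsoluteAnabelian.HolomorphicEllipticCuspidalization.NsmulImmComplement := by
  intro ι _ Φ N hN
  refine ⟨?_, not_mem_range_nsmulImm_iff Φ N⟩
  -- the `N`-torsion points of the torus form a finite set
  have hfinT : {t : ComplexTorus Φ | N • t = 0}.Finite := by
    have hfin : (Set.pi Set.univ fun _ : ι => {a : AddCircle (1 : ℝ) | N • a = 0}).Finite :=
      Set.Finite.pi fun _ => AddCircle.finite_torsion (1 : ℝ) (Nat.pos_of_ne_zero hN)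
    refine hfin.subset ?_
    intro t ht i _
    have h := congr_fun (show (N • t : ι → AddCircle (1 : ℝ)) = 0 from ht) i
    simpa using h
  have hsub : (Set.range (nsmulImm Φ N))ᶜ ⊆
      ((↑) : puncturedTorus Φ → ComplexTorus Φ) ⁻¹' {t : ComplexTorus Φ | N • t = 0} := by
    intro x hx
    exact (not_mem_range_nsmulImm_iff Φ N x).1 hx
  exact (hfinT.preimage Subtype.val_injective.injOn).subset hsub

/-! ### Connectedness of the punctured torus -/

/-- The punctured torus `𝔼 = T ∖ {0}` is the image under the universal covering `ℂ → T` of the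
complement of the lattice. [cite: MochizukiAbsTopIII2015, Corollary 2.7 (a) pp.58–59] -/
theorem image_cover_compl_lattice :
    cover Φ '' (Set.range (latticeVec Φ))ᶜ = ((puncturedTorus Φ : Opens (ComplexTorus Φ)) :
      Set (ComplexTorus Φ)) := by
  ext t
  constructor
  · rintro ⟨z, hz, rfl⟩ h0
    have h0' : cover Φ z = 0 := h0
    obtain ⟨n, hn⟩ := (cover_eq_zero_iff Φ z).1 h0'
    exact hz ⟨n, hn.symm⟩
  · intro ht
    obtain ⟨z, rfl⟩ := cover_surjective Φ t
    refine ⟨z, fun ⟨n, hn⟩ => ht ?_, rfl⟩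
    show cover Φ z = 0
    exact (cover_eq_zero_iff Φ z).2 ⟨n, hn.symm⟩

/-- The punctured torus `𝔼 = T ∖ {0}` is connected (the complement of the countable lattice in `ℂ`,
of real dimension `2 > 1`, is path connected). [cite: MochizukiAbsTopIII2015, Corollary 2.7 (a) pp.58–59] -/
theorem isConnected_puncturedTorus :
    IsConnected ((puncturedTorus Φ : Opens (ComplexTorus Φ)) : Set (ComplexTorus Φ)) := by
  have hL : (Set.range (latticeVec Φ)).Countable := Set.countable_range _
  have hrank : 1 < Module.rank ℝ ℂ := by
    rw [Complex.rank_real_complex]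
    norm_num
  have hpc : IsPathConnected (Set.range (latticeVec Φ))ᶜ := hL.isPathConnected_compl_of_one_lt_rank hrank
  rw [← image_cover_compl_lattice]
  exact hpc.isConnected.image _ (continuous_cover Φ).continuousOn

/-- The punctured torus is a connected space (a theorem, to be invoked with `haveI`).
[cite: MochizukiAbsTopIII2015, Corollary 2.7 (a) pp.58–59] -/
theorem connectedSpace_puncturedTorus : ConnectedSpace (puncturedTorus Φ) :=
  isConnected_iff_connectedSpace.1 (isConnected_puncturedTorus Φ)

/-! ### Holomorphy of `[N]` and of the inclusion; (b).6 -/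

/-- `𝕌_N ⊆ 𝔼`: an element with `N • x ≠ 0` is non-zero. [cite: MochizukiAbsTopIII2015, Corollary 2.7 (b) p.59] -/
theorem nsmulLocus_le (N : ℕ) : nsmulLocus Φ N ≤ puncturedTorus Φ := by
  intro x hx h0
  have hx0 : (x : ComplexTorus Φ) = 0 := h0
  apply hx
  show N • x ∈ ({0} : Set (ComplexTorus Φ))
  rw [hx0, smul_zero]
  rfl

/-- The open immersion `𝕌_N ↪ 𝔼` is the inclusion of opens. [cite: MochizukiAbsTopIII2015, Corollary 2.7 (b) p.59] -/
theorem nsmulImm_eq_inclusion (N : ℕ) :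
    nsmulImm Φ N = TopologicalSpace.Opens.inclusion (nsmulLocus_le Φ N) := rfl

/-- The inclusion `𝕌_N ↪ 𝔼` is holomorphic (any smoothness degree). [cite: MochizukiAbsTopIII2015, Corollary 2.7 (b) p.59] -/
theorem contMDiff_nsmulImm (N : ℕ) {n : WithTop ℕ∞} :
    ContMDiff 𝓘(ℂ, ℂ) 𝓘(ℂ, ℂ) n (nsmulImm Φ N) := by
  rw [nsmulImm_eq_inclusion]
  exact contMDiff_inclusion (nsmulLocus_le Φ N)

/-- The covering `[N] : 𝕌_N → 𝔼` is holomorphic (any smoothness degree): multiplication by `N` is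
holomorphic on the torus (`ComplexTorus.contMDiff_zsmul`), restricted to opens.
[cite: MochizukiAbsTopIII2015, Corollary 2.7 (b) p.59] -/
theorem contMDiff_nsmulCov (N : ℕ) {n : WithTop ℕ∞} :
    ContMDiff 𝓘(ℂ, ℂ) 𝓘(ℂ, ℂ) n (nsmulCov Φ N) := by
  intro x
  -- multiplication by `N` on the whole torus, restricted to the open `𝕌_N`
  have hT : ContMDiff 𝓘(ℂ, ℂ) 𝓘(ℂ, ℂ) n (fun t : ComplexTorus Φ => (N : ℤ) • t) :=
    Literature.Geometry.Kaehler.ComplexTorus.contMDiff_zsmul (𝕜 := ℂ) (N : ℤ)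
  have hres : ContMDiffAt 𝓘(ℂ, ℂ) 𝓘(ℂ, ℂ) n
      (fun u : nsmulLocus Φ N => (N : ℤ) • (u : ComplexTorus Φ)) x :=
    contMDiffAt_subtype_iff.mpr (hT x)
  have hval : (Subtype.val ∘ nsmulCov Φ N) = fun u : nsmulLocus Φ N => (N : ℤ) • (u : ComplexTorus Φ) := by
    funext u
    simp [natCast_zsmul]
  have hcomp : ContMDiffAt 𝓘(ℂ, ℂ) 𝓘(ℂ, ℂ) n (Subtype.val ∘ nsmulCov Φ N) x := by
    rw [hval]
    exact hres
  exact (ChartedSpace.liftPropWithinAt_subtypeVal_comp_iff _ _ _).mp hcomp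

/-- `[N] : 𝕌_N → 𝔼` is holomorphic at every point. [cite: MochizukiAbsTopIII2015, Corollary 2.7 (b) p.59] -/
theorem isHolAt_nsmulCov (N : ℕ) (x : nsmulLocus Φ N) : IsHolAt (nsmulCov Φ N) x :=
  Filter.Eventually.of_forall fun y =>
    ((contMDiff_nsmulCov Φ N (n := ω)) y).mdifferentiableAt (by simp)

/-- The inclusion `𝕌_N ↪ 𝔼` is holomorphic at every point. [cite: MochizukiAbsTopIII2015, Corollary 2.7 (b) p.59] -/
theorem isHolAt_nsmulImm (N : ℕ) (x : nsmulLocus Φ N) : IsHolAt (nsmulImm Φ N) x :=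
  Filter.Eventually.of_forall fun y =>
    ((contMDiff_nsmulImm Φ N (n := ω)) y).mdifferentiableAt (by simp)

/-- **Sub-node (b).6 PROVED**: `[N]` and the inclusion are co-holomorphic in the Riemann-surface
form: they map (points of one connected component) into one connected component of the connected
`𝔼`, and are holomorphic together. [cite: MochizukiAbsTopIII2015, Corollary 2.7 (b) p.59] -/
theorem nsmulCoholomorphic_holds :
    Literature.AnabelianGeometry.AbsoluteAnabelian.HolomorphicEllipticCuspidalization.NsmulCoholomorphic := by
  intro ι _ Φ N _ x x' _
  haveI := connectedSpace_puncturedTorus Φ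
  refine ⟨?_, ⟨fun _ => isHolAt_nsmulImm Φ N x', fun _ => isHolAt_nsmulCov Φ N x⟩⟩
  rw [PreconnectedSpace.connectedComponent_eq_univ, PreconnectedSpace.connectedComponent_eq_univ]

/-! ### (b).2, (b).4: morphisms of the associated Aut-holomorphic spaces -/

/-- `[N] : 𝕌_N → 𝔼` (`N ≠ 0`) is a local homeomorphism: multiplication by `N` is the isogeny
`ρ(N • 1)` of the torus, a covering map (`ComplexTorus.IsIsogeny.isCoveringMap'`), and its restriction
to the preimage `𝕌_N` of the open `𝔼` is again a covering map.  (Private copy of the covering step of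
sub-node (b).1, whose closing theorem is abc-iut-w5-d226's `nsmulCovIsFiniteEtale_holds`.)
[cite: MochizukiAbsTopIII2015, Corollary 2.7 (b) p.59] -/
private theorem isLocalHomeomorph_nsmulCov {N : ℕ} (hN : N ≠ 0) :
    IsLocalHomeomorph (nsmulCov Φ N) := by
  classical
  have hfun : (fun x : ComplexTorus Φ => N • x) =
      Literature.Geometry.Kaehler.ComplexTorus.mapMatrix Φ Φ ((N : ℤ) • (1 : Matrix ι ι ℤ)) := by
    funext x
    rw [Literature.Geometry.Kaehler.ComplexTorus.mapMatrix_smul,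
      Literature.Geometry.Kaehler.ComplexTorus.mapMatrix_one, natCast_zsmul]
  have hN' : (N : ℤ) ≠ 0 := by exact_mod_cast hN
  have hcov : IsCoveringMap (fun x : ComplexTorus Φ => N • x) := by
    rw [hfun]
    exact (Literature.Geometry.Kaehler.ComplexTorus.isIsogeny_smul_one Φ hN').isCoveringMap'
  have hres : IsCoveringMap (nsmulCov Φ N) :=
    hcov.restrictPreimage (puncturedTorus Φ : Set (ComplexTorus Φ))
  exact hres.isLocalHomeomorph

/-- The inclusion `𝕌_N ↪ 𝔼` is an open embedding. [cite: MochizukiAbsTopIII2015, Corollary 2.7 (b) p.59] -/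
theorem isOpenEmbedding_nsmulImm (N : ℕ) : IsOpenEmbedding (nsmulImm Φ N) := by
  rw [nsmulImm_eq_inclusion]
  exact TopologicalSpace.Opens.isOpenEmbedding_of_le (nsmulLocus_le Φ N)

/-- **Sub-node (b).2 PROVED**: `[N] : 𝕌_N → 𝔼` is a morphism of the associated Aut-holomorphic
spaces — étale (a local homeomorphism, being a covering map) and holomorphic, hence a `(𝒰,𝒱)`-local
morphism for all local structures by abc-iut-L4-t8's `isLocalMorphism_ofCharted_of_isRCHolomorphic`
(converse of Cor 2.3 (i)).
[cite: MochizukiAbsTopIII2015, Corollary 2.7 (b) p.59] -/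
theorem nsmulCovIsMorphism_holds :
    Literature.AnabelianGeometry.AbsoluteAnabelian.HolomorphicEllipticCuspidalization.NsmulCovIsMorphism := by
  intro ι _ Φ N hN
  exact isLocalMorphism_ofCharted_of_isRCHolomorphic (isLocalHomeomorph_nsmulCov Φ hN)
    (fun x => Or.inl (isHolAt_nsmulCov Φ N x)) _ _

/-- **Sub-node (b).4 PROVED**: the inclusion `𝕌_N ↪ 𝔼` is an open embedding and a morphism of the
associated Aut-holomorphic spaces (étale holomorphic ⇒ local morphism, as for (b).2).
[cite: MochizukiAbsTopIII2015, Corollary 2.7 (b) p.59] -/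
theorem nsmulImmIsMorphism_holds :
    Literature.AnabelianGeometry.AbsoluteAnabelian.HolomorphicEllipticCuspidalization.NsmulImmIsMorphism := by
  intro ι _ Φ N _
  exact ⟨isOpenEmbedding_nsmulImm Φ N, isLocalMorphism_ofCharted_of_isRCHolomorphic
    (isOpenEmbedding_nsmulImm Φ N).isLocalHomeomorph (fun x => Or.inl (isHolAt_nsmulImm Φ N x)) _ _⟩

/-! ### (c).6: the one-point compactification of the punctured torus -/

/-- **Sub-node (c).6 PROVED**: the inclusion `𝔼 ↪ T` extends to a homeomorphism
`OnePoint 𝔼 ≃ₜ T` sending `∞` to `0` ("[the one-point compactification of] `E^top`" is the torus).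
[cite: MochizukiAbsTopIII2015, Corollary 2.7 (c) p.59] -/
theorem onePointPuncturedTorus_holds :
    Literature.AnabelianGeometry.AbsoluteAnabelian.HolomorphicEllipticCuspidalization.OnePointPuncturedTorus := by
  intro ι _ Φ
  have hrange : Set.range ((↑) : puncturedTorus Φ → ComplexTorus Φ) = {(0 : ComplexTorus Φ)}ᶜ := by
    ext t
    simp [puncturedTorus]
  refine ⟨OnePoint.equivOfIsEmbeddingOfRangeEq (0 : ComplexTorus Φ) ((↑) : puncturedTorus Φ → ComplexTorus Φ)
    IsEmbedding.subtypeVal hrange, ?_, fun x => ?_⟩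
  · exact OnePoint.equivOfIsEmbeddingOfRangeEq_apply_infty _ _ _ _
  · exact OnePoint.equivOfIsEmbeddingOfRangeEq_apply_coe _ _ _ _ x

end HolomorphicEllipticCuspidalization

end Literature.AnabelianGeometry.AbsoluteAnabelian

end
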